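/-
Copyright: the b2b-balaban T⁴-continuum CRUX team, row NE7b leaf lineage `t4-ne7b-formalise-leaf-06` (gen 158; §5 gen 159). Project licence.
-/
import Summits.QuantumFields.BalabanUV.T4Continuum.Spine.NE7b.OneShotChartMixedNorm
import Summits.QuantumFields.BalabanUV.T4Continuum.Spine.NE7b.BlockPropagatorMixedNorm
import Summits.QuantumFields.BalabanUV.T4Continuum.Spine.NE7b.FibreSupUniqueness

/-!
# THE FIBRE INVERSE `Γ = G′ − H·Q′G′` AND THE AUGMENTED INVERSE `φ = H·k + Γ·ψ` IN THE MIXED CURRENCY `ℓ^∞(blocks; block-RMS)`: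
# `‖Q′‖_{mix→ℓ^∞} ≤ 1`, `‖Γ‖_{mix→mix} ≤ c_uK_d(δ_u)·(1 + c_HK_d(δ_H))`, and HSCR's `‖T⁻¹y‖ ≤ N‖y‖` SHAPE with
# `N = (c_HK_d(δ_H), c_uK_d(δ_u)(1 + c_HK_d(δ_H)))` displayed — every `d`, every mesh, finite windows
# (row NE7b, node U5c; the mixed-currency analogue of the OWNER's (51) `…FibreInverseSupNorm`; [folklore] bookkeeping over
# `…OneShotChartMixedNorm` + `…BlockPropagatorMixedNorm`)

Cell `pub-balaban`, sub-cell `t4`, spine estimate NE7b (`T4WeightBudget.RelWeightBound`; the cell's OWN estimate — NOT PRINTED in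
[Bałaban 1983–89], NOT PROVED).  Crux-route work under `Spine/NE7b/` by leaf-06 (CRUX team (2), FREEZE (0) crux-prover clause).
NOTHING of Bałaban's is named as a Lean object, valued or asserted; no `T4Continuum/Support` leaf typed; no `def`; zero `sorry`.

WHY.  The OWNER's RULING W-ne7bp1-g113-3 reads the hard-step cell's radius letter OF RECORD in the mixed currency of PRICING-NE7b v122
F727 (d) and lists the `T⁻¹` letters that must transfer: the section column (`…OneShotChartMixedNorm.blockRMS_HB_le_sup`:
`‖H‖_{ℓ^∞(coarse)→mix} ≤ c_HK_d(δ_H)`) and the fibre-inverse column (`…BlockPropagatorMixedNorm.blockRMS_Gpsi_le_mix`: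
`‖G′‖_{mix→mix} ≤ c_uK_d(δ_u)`).  The OWNER's (51) assembles, in the SUP currency, the fibre inverse `Γψ = G′ψ − H·Q′(G′ψ)` and the
augmented inverse `φ = Hk + Γψ` (with the currency-free identities `Q′Γψ = 0`, `AΓψ ≡ ψ mod Q′*` — NOT restated here).  THIS FILE is the
mixed-currency norm bookkeeping of the same two objects on finite windows: Jensen for `Q′`, composition, Minkowski on a block.

WHAT IS PROVED (`a > 0`; finite fine window `W` (blocks `B(y′)`, `y′ ∈ W`) and finite coarse window `T`; `G′_Wψ := Σ_{y′∈W}Σ_{q∈B(y′)}G′(·,q)ψ(q)`,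
`Q′f(y) := (n+1)^{−d}Σ_{p∈B(y)}f(p)`, `H_TB := Σ_{y∈T}H(·,y)B(y)`, `RMS_{B(y)}(f) := √((n+1)^{−d}Σ_{p∈B(y)}f(p)²)`; all [folklore]):
* §1 **`abs_blockAvg_le_blockRMS`** (`|Q′f(y)| ≤ RMS_{B(y)}(f)` — Jensen ∕ Cauchy–Schwarz on the block; `‖Q′‖_{mix→ℓ^∞(coarse)} ≤ 1`).
* §2 **`blockRMS_HQGpsi_le`** (`RMS_{B(y′)}(ψ) ≤ ρ` on `W`, `0 ≤ ρ` ⇒ `RMS_{B(y″)}(H_T(Q′(G′_Wψ))) ≤ c_HK_d(δ_H)·c_uK_d(δ_u)·ρ`).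
* §3 `sqrt_sum_sq_sub_le` (Minkowski on a finite set, difference form), **`blockRMS_fibreInverse_le`**
  (`RMS_{B(y″)}(G′_Wψ − H_T(Q′(G′_Wψ))) ≤ c_uK_d(δ_u)·(1 + c_HK_d(δ_H))·ρ` — `‖Γ‖_{mix→mix}` with the tree's displayed constants).
* §4 **`augInverse_mixed_letters`** (`|k| ≤ R_k` on `T`, `RMS(ψ) ≤ ρ` on `W` ⇒
  `RMS_{B(y″)}(H_Tk + Γψ) ≤ c_HK_d(δ_H)·R_k + c_uK_d(δ_u)(1 + c_HK_d(δ_H))·ρ` — HSCR's `‖T⁻¹y‖ ≤ N‖y‖` SHAPE in the currency of record).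
* §5 (v1.2) `abs_le_of_blockRMS_le` (uniform block-RMS bound ⇒ sup bound `√((n+1)^d)·ρ`), **`augmented_unique_mixed`** — UNIQUENESS of the
  augmented inverse among block-RMS-bounded fine fields, the OWNER's (52) `FibreSupUniqueness.augmented_unique` BY NAME (import added in v1.2).

HONEST: by value EMPTY (the tree's `cH ∕ deltaH ∕ cU ∕ deltaU` families); the identities of (51) are cited, not restated; `ℤ^d`, finite windows,
no torus; nothing of (A3) ∕ NC-NE7b-α.  BY-NAME EFFECT ON THE WALL: NONE.  NE7b NOT PRINTED ∕ NOT PROVED; spine PROVED 0∕9; rung (B)+1 on a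
FINITE torus — NOT infinite volume, NOT the mass gap, NOT Clay.  HONEST DEPENDENCY: continuum YM on T⁴ ⇐ BetaPertH ∧ nine spine estimates
(0∕9 proved); BetaPertH ⇐ (D1) ∧ (D4) ∧ CAP+tail; G-an2-4 gates asym, D1 and NE2∕3∕4.
-/

set_option autoImplicit false

namespace Summit.QuantumFields.BalabanUV.T4Continuum.NE7b.FibreInverseMixedNorm

open Finset
open Literature.MathematicalPhysics.QuantumFieldTheory.Balaban1983to89
open B4Sect5Proof (latticeConst latticeConst_nonneg)
open B6QGQLower276 (X B)
open B6QGQDecay237 (cU deltaU deltaU_pos cU_pos card_B)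
open B5Hk103ScalarZd (kerH Gk cH deltaH cH_pos deltaH_pos)
open OneShotChartMixedNorm (blockRMS_HB_le_sup)
open BlockPropagatorMixedNorm (blockRMS_Gpsi_le_mix)

variable {d : ℕ}

/-! ## §1. Jensen: `‖Q′‖_{mix → ℓ^∞(coarse)} ≤ 1` -/

/-- **`|Q′f(y)| ≤ RMS_{B(y)}(f)`**: the block average is dominated by the block RMS (Cauchy–Schwarz against the constant `1` on the
`(n+1)^d` points of the block). [folklore] -/
theorem abs_blockAvg_le_blockRMS (n : ℕ) (y : X d) (f : X d → ℝ) :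
    |(((n : ℝ) + 1) ^ d)⁻¹ * ∑ p ∈ B n y, f p| ≤ Real.sqrt ((((n : ℝ) + 1) ^ d)⁻¹ * ∑ p ∈ B n y, f p ^ 2) := by
  have hN : (0 : ℝ) < ((n : ℝ) + 1) ^ d := by positivity
  have hcard : ((B n y).card : ℝ) = ((n : ℝ) + 1) ^ d := card_B n y
  have hcs := Finset.sum_mul_sq_le_sq_mul_sq (B n y) (fun _ => (1 : ℝ)) f
  simp only [one_pow, Finset.sum_const, nsmul_eq_mul, mul_one, one_mul] at hcs
  rw [hcard] at hcs
  -- `(Σ f)² ≤ (n+1)^d · Σ f²`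
  have h0 : 0 ≤ ∑ p ∈ B n y, f p ^ 2 := Finset.sum_nonneg fun _ _ => sq_nonneg _
  rw [← Real.sqrt_sq_eq_abs]
  apply Real.sqrt_le_sqrt
  rw [mul_pow, sq, sq]
  calc (((n : ℝ) + 1) ^ d)⁻¹ * (((n : ℝ) + 1) ^ d)⁻¹ * ((∑ p ∈ B n y, f p) * ∑ p ∈ B n y, f p)
      ≤ (((n : ℝ) + 1) ^ d)⁻¹ * (((n : ℝ) + 1) ^ d)⁻¹ * (((n : ℝ) + 1) ^ d * ∑ p ∈ B n y, f p ^ 2) := by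
        refine mul_le_mul_of_nonneg_left ?_ (by positivity)
        simpa [sq] using hcs
    _ = (((n : ℝ) + 1) ^ d)⁻¹ * ∑ p ∈ B n y, f p ^ 2 := by field_simp

/-! ## §2. The composition `H·Q′·G′` -/

/-- **`RMS_{B(y″)}(H_T(Q′(G′_Wψ))) ≤ c_HK_d(δ_H)·c_uK_d(δ_u)·ρ`** whenever `RMS_{B(y′)}(ψ) ≤ ρ` on `W` (`0 ≤ ρ`): the section column
(`…OneShotChartMixedNorm`) after Jensen (§1) after the propagator column (`…BlockPropagatorMixedNorm`). [folklore] -/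
theorem blockRMS_HQGpsi_le (n : ℕ) {a : ℝ} (ha : 0 < a) (y'' : X d) (T W : Finset (X d)) (ψ : X d → ℝ) {ρ : ℝ}
    (hρ : 0 ≤ ρ) (hψ : ∀ y' ∈ W, Real.sqrt ((((n : ℝ) + 1) ^ d)⁻¹ * ∑ q ∈ B n y', ψ q ^ 2) ≤ ρ) :
    Real.sqrt ((((n : ℝ) + 1) ^ d)⁻¹ * ∑ p ∈ B n y'',
        (∑ y ∈ T, kerH n a p y
          * ((((n : ℝ) + 1) ^ d)⁻¹ * ∑ q' ∈ B n y, ∑ y' ∈ W, ∑ q ∈ B n y', Gk n a q' q * ψ q)) ^ 2)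
      ≤ cH d a * latticeConst d (deltaH d a) * (cU d a * latticeConst d (deltaU d a) * ρ) := by
  have hR : 0 ≤ cU d a * latticeConst d (deltaU d a) * ρ :=
    mul_nonneg (mul_nonneg (cU_pos d ha).le (latticeConst_nonneg d (deltaU_pos d ha).le)) hρ
  refine blockRMS_HB_le_sup n ha y'' T _ hR fun y _ => ?_
  exact (abs_blockAvg_le_blockRMS n y _).trans (blockRMS_Gpsi_le_mix n ha y W ψ hρ hψ)

/-! ## §3. Minkowski on a block and `‖Γ‖_{mix→mix}` -/

/-- Minkowski on a finite set, difference form: `√(Σ(u − v)²) ≤ √(Σu²) + √(Σv²)`. [folklore] -/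
theorem sqrt_sum_sq_sub_le {ι : Type*} (S : Finset ι) (u v : ι → ℝ) :
    Real.sqrt (∑ i ∈ S, (u i - v i) ^ 2) ≤ Real.sqrt (∑ i ∈ S, u i ^ 2) + Real.sqrt (∑ i ∈ S, v i ^ 2) := by
  have hu : 0 ≤ ∑ i ∈ S, u i ^ 2 := Finset.sum_nonneg fun _ _ => sq_nonneg _
  have hv : 0 ≤ ∑ i ∈ S, v i ^ 2 := Finset.sum_nonneg fun _ _ => sq_nonneg _
  have hrhs : 0 ≤ Real.sqrt (∑ i ∈ S, u i ^ 2) + Real.sqrt (∑ i ∈ S, v i ^ 2) := by positivity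
  rw [Real.sqrt_le_left hrhs]
  have hcs : (∑ i ∈ S, u i * v i) ^ 2 ≤ (∑ i ∈ S, u i ^ 2) * (∑ i ∈ S, v i ^ 2) := Finset.sum_mul_sq_le_sq_mul_sq S u v
  have hcs' : -(∑ i ∈ S, u i * v i) ≤ Real.sqrt (∑ i ∈ S, u i ^ 2) * Real.sqrt (∑ i ∈ S, v i ^ 2) := by
    rw [← Real.sqrt_mul hu]
    refine (neg_le_abs _).trans ?_
    rw [← Real.sqrt_sq_eq_abs]
    exact Real.sqrt_le_sqrt hcs
  have e : ∑ i ∈ S, (u i - v i) ^ 2 = ∑ i ∈ S, u i ^ 2 + ∑ i ∈ S, v i ^ 2 - 2 * ∑ i ∈ S, u i * v i := by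
    rw [← Finset.sum_add_distrib, Finset.mul_sum, ← Finset.sum_sub_distrib]
    exact Finset.sum_congr rfl fun i _ => by ring
  rw [e, add_sq, Real.sq_sqrt hu, Real.sq_sqrt hv]
  nlinarith [hcs']

/-- **`‖Γ‖_{mix→mix} ≤ c_uK_d(δ_u)·(1 + c_HK_d(δ_H))`** for the fibre inverse `Γ = G′ − H·Q′G′` (finite windows): whenever
`RMS_{B(y′)}(ψ) ≤ ρ` on `W` (`0 ≤ ρ`), `RMS_{B(y″)}(G′_Wψ − H_T(Q′(G′_Wψ))) ≤ c_uK_d(δ_u)(1 + c_HK_d(δ_H))·ρ` — every `d`, every mesh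
(Minkowski + the two columns). [folklore] -/
theorem blockRMS_fibreInverse_le (n : ℕ) {a : ℝ} (ha : 0 < a) (y'' : X d) (T W : Finset (X d)) (ψ : X d → ℝ) {ρ : ℝ}
    (hρ : 0 ≤ ρ) (hψ : ∀ y' ∈ W, Real.sqrt ((((n : ℝ) + 1) ^ d)⁻¹ * ∑ q ∈ B n y', ψ q ^ 2) ≤ ρ) :
    Real.sqrt ((((n : ℝ) + 1) ^ d)⁻¹ * ∑ p ∈ B n y'',
        ((∑ y' ∈ W, ∑ q ∈ B n y', Gk n a p q * ψ q)
          - ∑ y ∈ T, kerH n a p y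
            * ((((n : ℝ) + 1) ^ d)⁻¹ * ∑ q' ∈ B n y, ∑ y' ∈ W, ∑ q ∈ B n y', Gk n a q' q * ψ q)) ^ 2)
      ≤ cU d a * latticeConst d (deltaU d a) * (1 + cH d a * latticeConst d (deltaH d a)) * ρ := by
  have hN : (0 : ℝ) < ((n : ℝ) + 1) ^ d := by positivity
  have hNinv : 0 ≤ (((n : ℝ) + 1) ^ d)⁻¹ := inv_nonneg.mpr hN.le
  have h1 := blockRMS_Gpsi_le_mix n ha y'' W ψ hρ hψ
  have h2 := blockRMS_HQGpsi_le n ha y'' T W ψ hρ hψ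
  -- Minkowski on the block, then the normalisation `√((n+1)^{−d})` distributes
  have hM := sqrt_sum_sq_sub_le (B n y'')
    (fun p => ∑ y' ∈ W, ∑ q ∈ B n y', Gk n a p q * ψ q)
    (fun p => ∑ y ∈ T, kerH n a p y
      * ((((n : ℝ) + 1) ^ d)⁻¹ * ∑ q' ∈ B n y, ∑ y' ∈ W, ∑ q ∈ B n y', Gk n a q' q * ψ q))
  rw [Real.sqrt_mul hNinv]
  rw [Real.sqrt_mul hNinv] at h1 h2
  calc Real.sqrt ((((n : ℝ) + 1) ^ d)⁻¹) * Real.sqrt (∑ p ∈ B n y'',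
          ((∑ y' ∈ W, ∑ q ∈ B n y', Gk n a p q * ψ q)
            - ∑ y ∈ T, kerH n a p y
              * ((((n : ℝ) + 1) ^ d)⁻¹ * ∑ q' ∈ B n y, ∑ y' ∈ W, ∑ q ∈ B n y', Gk n a q' q * ψ q)) ^ 2)
      ≤ Real.sqrt ((((n : ℝ) + 1) ^ d)⁻¹) * (Real.sqrt (∑ p ∈ B n y'', (∑ y' ∈ W, ∑ q ∈ B n y', Gk n a p q * ψ q) ^ 2)
          + Real.sqrt (∑ p ∈ B n y'', (∑ y ∈ T, kerH n a p y
              * ((((n : ℝ) + 1) ^ d)⁻¹ * ∑ q' ∈ B n y, ∑ y' ∈ W, ∑ q ∈ B n y', Gk n a q' q * ψ q)) ^ 2)) :=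
        mul_le_mul_of_nonneg_left hM (Real.sqrt_nonneg _)
    _ ≤ cU d a * latticeConst d (deltaU d a) * ρ
          + cH d a * latticeConst d (deltaH d a) * (cU d a * latticeConst d (deltaU d a) * ρ) := by
        rw [mul_add]; exact add_le_add h1 h2
    _ = cU d a * latticeConst d (deltaU d a) * (1 + cH d a * latticeConst d (deltaH d a)) * ρ := by ring

/-! ## §4. The augmented inverse: HSCR's `‖T⁻¹y‖ ≤ N‖y‖` shape in the mixed currency -/

/-- **THE AUGMENTED INVERSE IN THE MIXED CURRENCY**: for `φ = H_Tk + Γψ` (`Γ = G′_W − H_TQ′G′_W`, finite windows), `|k| ≤ R_k` on `T`,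
`RMS_{B(y′)}(ψ) ≤ ρ` on `W` (`0 ≤ R_k`, `0 ≤ ρ`): `RMS_{B(y″)}(φ) ≤ c_HK_d(δ_H)·R_k + c_uK_d(δ_u)(1 + c_HK_d(δ_H))·ρ` — HSCR's `‖T⁻¹(k,ψ)‖ ≤ N·‖(k,ψ)‖`
SHAPE with `N` DISPLAYED, every `d`, every mesh (the identities making `φ` an inverse are the OWNER's (51), by name). [folklore] -/
theorem augInverse_mixed_letters (n : ℕ) {a : ℝ} (ha : 0 < a) (y'' : X d) (T W : Finset (X d)) (k ψ : X d → ℝ) {Rk ρ : ℝ}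
    (hRk : 0 ≤ Rk) (hk : ∀ y ∈ T, |k y| ≤ Rk)
    (hρ : 0 ≤ ρ) (hψ : ∀ y' ∈ W, Real.sqrt ((((n : ℝ) + 1) ^ d)⁻¹ * ∑ q ∈ B n y', ψ q ^ 2) ≤ ρ) :
    Real.sqrt ((((n : ℝ) + 1) ^ d)⁻¹ * ∑ p ∈ B n y'',
        ((∑ y ∈ T, kerH n a p y * k y)
          + ((∑ y' ∈ W, ∑ q ∈ B n y', Gk n a p q * ψ q)
            - ∑ y ∈ T, kerH n a p y
              * ((((n : ℝ) + 1) ^ d)⁻¹ * ∑ q' ∈ B n y, ∑ y' ∈ W, ∑ q ∈ B n y', Gk n a q' q * ψ q))) ^ 2)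
      ≤ cH d a * latticeConst d (deltaH d a) * Rk
        + cU d a * latticeConst d (deltaU d a) * (1 + cH d a * latticeConst d (deltaH d a)) * ρ := by
  have hN : (0 : ℝ) < ((n : ℝ) + 1) ^ d := by positivity
  have hNinv : 0 ≤ (((n : ℝ) + 1) ^ d)⁻¹ := inv_nonneg.mpr hN.le
  have h1 := blockRMS_HB_le_sup n ha y'' T k hRk hk
  have h2 := blockRMS_fibreInverse_le n ha y'' T W ψ hρ hψ
  -- Minkowski, sum form (the tree's `NE3EnergyHessContTwoTerm.sqrt_sum_sq_add_le` shape, obtained here from the difference form)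
  have hM := sqrt_sum_sq_sub_le (B n y'') (fun p => ∑ y ∈ T, kerH n a p y * k y)
    (fun p => -((∑ y' ∈ W, ∑ q ∈ B n y', Gk n a p q * ψ q)
      - ∑ y ∈ T, kerH n a p y
        * ((((n : ℝ) + 1) ^ d)⁻¹ * ∑ q' ∈ B n y, ∑ y' ∈ W, ∑ q ∈ B n y', Gk n a q' q * ψ q)))
  simp only [sub_neg_eq_add, neg_sq] at hM
  rw [Real.sqrt_mul hNinv]
  rw [Real.sqrt_mul hNinv] at h1 h2
  calc Real.sqrt ((((n : ℝ) + 1) ^ d)⁻¹) * Real.sqrt (∑ p ∈ B n y'',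
          ((∑ y ∈ T, kerH n a p y * k y)
            + ((∑ y' ∈ W, ∑ q ∈ B n y', Gk n a p q * ψ q)
              - ∑ y ∈ T, kerH n a p y
                * ((((n : ℝ) + 1) ^ d)⁻¹ * ∑ q' ∈ B n y, ∑ y' ∈ W, ∑ q ∈ B n y', Gk n a q' q * ψ q))) ^ 2)
      ≤ Real.sqrt ((((n : ℝ) + 1) ^ d)⁻¹) * (Real.sqrt (∑ p ∈ B n y'', (∑ y ∈ T, kerH n a p y * k y) ^ 2)
          + Real.sqrt (∑ p ∈ B n y'', ((∑ y' ∈ W, ∑ q ∈ B n y', Gk n a p q * ψ q)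
              - ∑ y ∈ T, kerH n a p y
                * ((((n : ℝ) + 1) ^ d)⁻¹ * ∑ q' ∈ B n y, ∑ y' ∈ W, ∑ q ∈ B n y', Gk n a q' q * ψ q)) ^ 2)) :=
        mul_le_mul_of_nonneg_left hM (Real.sqrt_nonneg _)
    _ ≤ cH d a * latticeConst d (deltaH d a) * Rk
        + cU d a * latticeConst d (deltaU d a) * (1 + cH d a * latticeConst d (deltaH d a)) * ρ := by
        rw [mul_add]; exact add_le_add h1 h2

/-! ## §5. Uniqueness in the mixed currency (v1.2; the OWNER's (52) `FibreSupUniqueness.augmented_unique` BY NAME)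

A uniform block-RMS bound is a (side-dependent) sup bound — `|φ(r)| ≤ √((n+1)^d)·ρ` — so (52)'s Liouville theorem on `ℓ^∞` pins down the
augmented inverse among block-RMS-bounded fine fields as well: §4 gives the SIZE of `φ = H_Tk + Γψ`, §5 says there is no other solution in the
currency of record (OWNER [NE7bP1-G113-INBOX-CLOSE]: «(52)'s `augmented_unique` serves FIMN's uniqueness clause by name if wanted»). -/

section Unique

open B6QGQLower276 (blk AX mem_B)
open B5Hk103ScalarZd (nbhd)

/-- **A UNIFORM BLOCK-RMS BOUND IS A SUP BOUND (side-dependent)**: if `RMS_{B(y)}(φ) ≤ ρ` for every block `y`, then `|φ(r)| ≤ √((n+1)^d)·ρ`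
for every fine site `r` (one term of the block sum over `B(blk r)`). [folklore] -/
theorem abs_le_of_blockRMS_le (n : ℕ) (φ : X d → ℝ) {ρ : ℝ}
    (hφ : ∀ y : X d, Real.sqrt ((((n : ℝ) + 1) ^ d)⁻¹ * ∑ p ∈ B n y, φ p ^ 2) ≤ ρ) (r : X d) :
    |φ r| ≤ Real.sqrt (((n : ℝ) + 1) ^ d) * ρ := by
  have hN : (0 : ℝ) < ((n : ℝ) + 1) ^ d := by positivity
  have hNinv : 0 ≤ (((n : ℝ) + 1) ^ d)⁻¹ := inv_nonneg.mpr hN.le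
  have hr : r ∈ B n (blk n r) := mem_B.2 rfl
  have h1 : φ r ^ 2 ≤ ∑ p ∈ B n (blk n r), φ p ^ 2 :=
    Finset.single_le_sum (f := fun p => φ p ^ 2) (fun p _ => sq_nonneg (φ p)) hr
  have h2 := hφ (blk n r)
  rw [Real.sqrt_mul hNinv, Real.sqrt_inv] at h2
  have hsq : 0 < Real.sqrt (((n : ℝ) + 1) ^ d) := Real.sqrt_pos.mpr hN
  rw [inv_mul_le_iff₀ hsq] at h2
  calc |φ r| = Real.sqrt (φ r ^ 2) := (Real.sqrt_sq_eq_abs _).symm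
    _ ≤ Real.sqrt (∑ p ∈ B n (blk n r), φ p ^ 2) := Real.sqrt_le_sqrt h1
    _ ≤ Real.sqrt (((n : ℝ) + 1) ^ d) * ρ := h2

/-- **UNIQUENESS OF THE AUGMENTED INVERSE IN THE MIXED CURRENCY** (every `d`, every mesh, `a > 0`): two fine fields with UNIFORMLY bounded
block-RMS, the same block sums, and images under `A` differing by a block-constant field, coincide — (52)'s `augmented_unique` read through
`abs_le_of_blockRMS_le`.  With §4 (`φ = H_Tk + Γψ` and its size) this is existence-with-letters AND uniqueness of HSCR's `T⁻¹` in the currency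
of record (the identities making `φ` an inverse are the OWNER's (51), by name). [folklore] -/
theorem augmented_unique_mixed (n : ℕ) {a : ℝ} (ha : 0 < a) {φ₁ φ₂ c₁ c₂ ψ : X d → ℝ} {ρ₁ ρ₂ : ℝ}
    (h₁ : ∀ y : X d, Real.sqrt ((((n : ℝ) + 1) ^ d)⁻¹ * ∑ p ∈ B n y, φ₁ p ^ 2) ≤ ρ₁)
    (h₂ : ∀ y : X d, Real.sqrt ((((n : ℝ) + 1) ^ d)⁻¹ * ∑ p ∈ B n y, φ₂ p ^ 2) ≤ ρ₂)
    (hA₁ : ∀ p : X d, ∑ r ∈ nbhd n p, AX n a p r * φ₁ r = ψ p + c₁ (blk n p))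
    (hA₂ : ∀ p : X d, ∑ r ∈ nbhd n p, AX n a p r * φ₂ r = ψ p + c₂ (blk n p))
    (hQ : ∀ z : X d, ∑ p ∈ B n z, φ₁ p = ∑ p ∈ B n z, φ₂ p) : φ₁ = φ₂ :=
  FibreSupUniqueness.augmented_unique n ha (abs_le_of_blockRMS_le n φ₁ h₁) (abs_le_of_blockRMS_le n φ₂ h₂) hA₁ hA₂ hQ

end Unique

end Summit.QuantumFields.BalabanUV.T4Continuum.NE7b.FibreInverseMixedNorm
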